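import Literature.AlgebraicTopology.SingularHomology.ProductKunnethField
import HarnessLib

/-!
# A vanishing criterion for classes on `M × N` (Künneth rigidity)

Let `F` be a field, `M` a paracompact Hausdorff space with an atlas on a second-countable real
normed space, and `N` a space whose cohomology has finite bases in degrees `≤ D` and vanishes
above `D`.  By the Künneth theorem (`LerayHirsch.bijective_lhMap_fst_prod`) every class
`z ∈ Hⁿ(M × N; F)` is uniquely `Σⱼ pr₁^* xⱼ ⌣ pr₂^* eⱼ` over the graded basis `(eⱼ)` of `H*(N)`.
We prove the following **vanishing criterion** (`eq_zero_of_tests`), for `k + l = n`: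

* (first factor) if for every `p ≤ k` there is a space `U_p` over `M`, `j_p : U_p → M`, again
  paracompact Hausdorff charted on the model space, with `j_p^* : Hᵖ(M) → Hᵖ(U_p)` injective and
  `(j_p × id)^* z = 0`, then the coefficients `xⱼ` of fibre degree `≥ l` vanish;
* (second factor) if there is a space `V` over `N`, `j_V : V → N`, with `j_V^* : H^q(N) → H^q(V)`
  injective for `q < l`, `H^q(V) = 0` for `q ≥ l`, all `H^q(V)` finite-dimensional, and
  `(id × j_V)^* z = 0`, then the coefficients of fibre degree `< l` vanish (the restricted classes
  `j_V^* eⱼ`, `deg eⱼ < l`, are independent and extend to a graded basis of `H*(V)`,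
  `Basis.sumExtend`; Künneth over `M` with fibre `V`);

hence `z = 0` under both.  This is the form in which Morse-theoretic handlebodies (first factor:
`Hᵖ(M) ↪ Hᵖ(M^{≤p})`; second factor: `N^{<l}`) detect classes on a product of compact manifolds.

Everything is proved; no named facts.

## References

* [HatcherAT2002] A. Hatcher, *Algebraic Topology*, CUP 2002, §3.2 Thm. 3.16, §4.D Thm. 4D.1.
* [HusemollerFibreBundles1994] D. Husemoller, *Fibre Bundles*, 3rd ed. (1994), Ch. 17 §1 Thm. 1.1.
-/

noncomputable section

open CategoryTheory Function Set

namespace Literature.AlgebraicTopology.SingularHomology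

namespace LerayHirsch

/-! ### Linear algebra: `Basis.sumExtend` extends the family -/

/-- `Basis.sumExtend` extends the given family: on the left summand it is `v` (copy of the tree's
`Literature.Computability.AlgebraicComplexity.sumExtend_inl`). [folklore] -/
theorem sumExtend_inl' {K V ι : Type*} [Field K] [AddCommGroup V] [Module K V] {v : ι → V}
    (hs : LinearIndependent K v) (i : ι) : Module.Basis.sumExtend hs (Sum.inl i) = v i := by
  classical
  simp only [Module.Basis.sumExtend, Trans.trans, Module.Basis.reindex_apply, Equiv.symm_symm, Module.Basis.coe_extend]
  change ((Equiv.Set.sumDiffSubset (hs.linearIndepOn_id.subset_extend _)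
    (Sum.inl (Equiv.ofInjective v hs.injective i)) : _) : V) = v i
  rw [Equiv.Set.sumDiffSubset_apply_inl]
  rfl

/-- A sum over `Fin (D + 1)` whose terms vanish from `l` on is the sum over `Fin l` (`l ≤ D + 1`).
[folklore] -/
theorem sum_fin_eq_sum_fin_castLE {A : Type*} [AddCommMonoid A] {D l : ℕ} (h : l ≤ D + 1) (S : Fin (D + 1) → A)
    (hS : ∀ q : Fin (D + 1), l ≤ (q : ℕ) → S q = 0) : ∑ q, S q = ∑ q : Fin l, S (Fin.castLE h q) := by
  classical
  let g : ℕ → A := fun m ↦ if hm : m < D + 1 then S ⟨m, hm⟩ else 0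
  have h1 : ∑ q : Fin (D + 1), S q = ∑ m ∈ Finset.range (D + 1), g m := by
    rw [← Fin.sum_univ_eq_sum_range]
    refine Finset.sum_congr rfl fun q _ ↦ ?_
    simp only [g, dif_pos q.isLt]
  have h2 : ∑ q : Fin l, S (Fin.castLE h q) = ∑ m ∈ Finset.range l, g m := by
    rw [← Fin.sum_univ_eq_sum_range]
    refine Finset.sum_congr rfl fun q _ ↦ ?_
    simp only [g, dif_pos (show (q : ℕ) < D + 1 by omega)]
    rfl
  rw [h1, h2]
  symm
  refine Finset.sum_subset (Finset.range_subset_range.2 h) fun m hm hml ↦ ?_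
  simp only [Finset.mem_range, not_lt] at hm hml
  simp only [g, dif_pos hm]
  exact hS _ hml

/-! ### The setting -/

variable (F : Type) [Field F] {M N : Type} [TopologicalSpace M] [TopologicalSpace N]
variable (E : Type) [NormedAddCommGroup E] [NormedSpace ℝ E] [SecondCountableTopology E]
variable [ChartedSpace E M] [T2Space M] [ParacompactSpace M]

section

variable {D : ℕ} {σ : Fin (D + 1) → Type} [∀ q, Fintype (σ q)]
  (v : (q : Fin (D + 1)) → σ q → singularCohomology F F N q)

/-- The graded family `e ⟨q, i⟩ = v q i` and its degree function. [folklore] -/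
abbrev deg : (Σ q : Fin (D + 1), σ q) → ℕ := fun j ↦ (j.1 : ℕ)

/-- The classes `pr₂^* eⱼ` on `M × N'` for a space `M`. [folklore] -/
abbrev sndCls (M : Type) [TopologicalSpace M] (j : Σ q : Fin (D + 1), σ q) : singularCohomology F F (M × N) (deg j) :=
  singularCohomology.map F F (ContinuousMap.snd : C(M × N, N)) (deg j) (v j.1 j.2)

/-! ### First factor: restriction to a space over `M` -/

include E in
omit [ChartedSpace E M] [T2Space M] [ParacompactSpace M] in
/-- **First-factor test.** If `z = θ(x) = Σⱼ pr₁^* xⱼ ⌣ pr₂^* eⱼ` and, for a space `U` over `M`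
(`jU : U → M`, paracompact Hausdorff charted on the model space) `(jU × id)^* z = 0`, then
`jU^* xⱼ = 0` for all `j` (naturality of `θ` and Künneth over `U`). [cite: HatcherAT2002, §3.2 Thm. 3.16] -/
theorem map_coeff_eq_zero_of_map_prod_eq_zero
    (hv : ∀ q, Bijective fun r : σ q → F ↦ ∑ i, r i • v q i)
    (hD : ∀ q, D < q → Subsingleton (singularCohomology F F N q))
    {U : Type} [TopologicalSpace U] [ChartedSpace E U] [T2Space U] [ParacompactSpace U] (jU : C(U, M))
    {n : ℕ} (x : Src F (deg (σ := σ)) M n)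
    (hz : singularCohomology.map F F (jU.prodMap (ContinuousMap.id N)) n
      (lhMap F deg (ContinuousMap.fst : C(M × N, M)) (sndCls F v M) n x) = 0) (j : Idx (deg (σ := σ)) n) :
    singularCohomology.map F F jU (n - deg j.1) (x j) = 0 := by
  have he := bijective_lhMap_const_of_basis F v hv hD
  have hsq : (ContinuousMap.fst : C(M × N, M)).comp (jU.prodMap (ContinuousMap.id N)) =
      jU.comp (ContinuousMap.fst : C(U × N, U)) := by
    ext p
    rfl
  rw [map_lhMap F deg _ _ _ _ hsq] at hz
  have hcls : (fun j ↦ singularCohomology.map F F (jU.prodMap (ContinuousMap.id N)) (deg j) (sndCls F v M j)) = sndCls F v U := by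
    funext j
    change singularCohomology.map F F _ _ (singularCohomology.map F F _ _ _) = _
    rw [← ModuleCat.comp_apply, ← singularCohomology.map_comp]
    rfl
  rw [hcls] at hz
  have hinj := (bijective_lhMap_fst_prod F deg (fun j ↦ v j.1 j.2) E he (M := U) n).1
  have hx : (fun j : Idx deg n ↦ singularCohomology.map F F jU (n - deg j.1) (x j)) = 0 :=
    hinj (hz.trans (map_zero _).symm)
  exact congrFun hx j

/-! ### Second factor: restriction to a space over `N` -/

include E in
/-- **Second-factor test.** If `z = θ(x)` and, for a space `V` over `N` (`jV : V → N`) with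
`jV^* : H^q(N) → H^q(V)` injective for `q < l`, `H^q(V) = 0` for `q ≥ l` and all `H^q(V)`
finite-dimensional, `(id × jV)^* z = 0`, then `xⱼ = 0` for all `j` of fibre degree `< l` (extend the
independent restricted classes to a graded basis of `H*(V)` and apply Künneth over `M` with fibre
`V`). [cite: HatcherAT2002, §3.2 Thm. 3.16] -/
theorem coeff_eq_zero_of_map_snd_eq_zero
    (hv : ∀ q, Bijective fun r : σ q → F ↦ ∑ i, r i • v q i)
    {V : Type} [TopologicalSpace V] (jV : C(V, N)) {l : ℕ} (hl : l ≤ D + 1)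
    (hVinj : ∀ q : Fin (D + 1), (q : ℕ) < l → Injective (singularCohomology.map F F jV q))
    (hVvan : ∀ q, l ≤ q → Subsingleton (singularCohomology F F V q))
    (hVfin : ∀ q, Module.Finite F (singularCohomology F F V q))
    {n : ℕ} (x : Src F (deg (σ := σ)) M n)
    (hz : singularCohomology.map F F ((ContinuousMap.id M).prodMap jV) n
      (lhMap F deg (ContinuousMap.fst : C(M × N, M)) (sndCls F v M) n x) = 0)
    (j : Idx (deg (σ := σ)) n) (hj : deg j.1 < l) : x j = 0 := by
  classical
  -- `l = l' + 1`
  obtain ⟨l', rfl⟩ : ∃ l', l = l' + 1 := ⟨l - 1, by omega⟩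
  -- the basis classes of degree `q < l`, re-indexed by `Fin (l' + 1)`, and their restrictions
  let v' : (q : Fin (l' + 1)) → σ (Fin.castLE hl q) → singularCohomology F F N q := fun q i ↦ v (Fin.castLE hl q) i
  let w : (q : Fin (l' + 1)) → σ (Fin.castLE hl q) → singularCohomology F F V q := fun q i ↦
    singularCohomology.map F F jV q (v' q i)
  have hinj' : ∀ q : Fin (l' + 1), Injective (singularCohomology.map F F jV q : singularCohomology F F N q → _) :=
    fun q ↦ hVinj (Fin.castLE hl q) q.isLt
  have hv' : ∀ q : Fin (l' + 1), Injective fun r : σ (Fin.castLE hl q) → F ↦ ∑ i, r i • v' q i :=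
    fun q ↦ (hv (Fin.castLE hl q)).1
  -- the restricted classes are independent
  have hli : ∀ q, LinearIndependent F (w q) := by
    intro q
    rw [Fintype.linearIndependent_iff]
    intro r hr i
    have e1 : singularCohomology.map F F jV q (∑ i, r i • v' q i) = ∑ i, r i • w q i := by
      rw [map_sum]
      refine Finset.sum_congr rfl fun i _ ↦ ?_
      rw [map_smul]
    have h0 : ∑ i, r i • v' q i = 0 := hinj' q ((e1.trans hr).trans (map_zero _).symm)
    have h0' : (fun r : σ (Fin.castLE hl q) → F ↦ ∑ i, r i • v' q i) r =
        (fun r : σ (Fin.castLE hl q) → F ↦ ∑ i, r i • v' q i) 0 := by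
      simp only [Pi.zero_apply, zero_smul, Finset.sum_const_zero]
      exact h0
    exact congrFun (hv' q h0') i
  -- extend to bases of the `H^q(V)`, `q ≤ l'`
  let B : (q : Fin (l' + 1)) → Module.Basis (σ (Fin.castLE hl q) ⊕ Module.Basis.sumExtendIndex (hli q)) F
      (singularCohomology F F V q) := fun q ↦ Module.Basis.sumExtend (hli q)
  haveI hfinI : ∀ q, Fintype (Module.Basis.sumExtendIndex (hli q)) := fun q ↦ by
    haveI : Finite (σ (Fin.castLE hl q) ⊕ Module.Basis.sumExtendIndex (hli q)) := Module.Finite.finite_basis (B q)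
    haveI : Finite (Module.Basis.sumExtendIndex (hli q)) :=
      Finite.of_injective (Sum.inr : _ → σ (Fin.castLE hl q) ⊕ Module.Basis.sumExtendIndex (hli q)) Sum.inr_injective
    exact Fintype.ofFinite _
  let τ : Fin (l' + 1) → Type := fun q ↦ σ (Fin.castLE hl q) ⊕ Module.Basis.sumExtendIndex (hli q)
  let vV : (q : Fin (l' + 1)) → τ q → singularCohomology F F V q := fun q s ↦ B q s
  have hvV_inl : ∀ q i, vV q (Sum.inl i) = w q i := fun q i ↦ sumExtend_inl' (hli q) i
  have hvV : ∀ q, Bijective fun r : τ q → F ↦ ∑ s, r s • vV q s := by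
    intro q
    have : (fun r : τ q → F ↦ ∑ s, r s • vV q s) = (B q).equivFun.symm :=
      funext fun r ↦ ((B q).equivFun_symm_apply r).symm
    rw [this]
    exact (B q).equivFun.symm.bijective
  have hDV : ∀ q, l' < q → Subsingleton (singularCohomology F F V q) := fun q hq ↦ hVvan q hq
  have heV := bijective_lhMap_const_of_basis F vV hvV hDV
  have hinjV := (bijective_lhMap_fst_prod F (deg (σ := τ)) (fun s ↦ vV s.1 s.2) E heV (M := M) n).1
  -- the extended coefficient vector
  let xt : Src F (deg (σ := τ)) M n := fun s ↦
    Sum.elim (fun i ↦ (x ⟨⟨Fin.castLE hl s.1.1, i⟩, s.2⟩ : singularCohomology F F M (n - deg s.1))) (fun _ ↦ 0) s.1.2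
  -- `(id × jV)^* z = θ(x)` over `M × V` with the restricted classes
  have hsq : (ContinuousMap.fst : C(M × N, M)).comp ((ContinuousMap.id M).prodMap jV) =
      (ContinuousMap.id M).comp (ContinuousMap.fst : C(M × V, M)) := by
    ext p
    rfl
  have hsq' : (ContinuousMap.snd : C(M × N, N)).comp ((ContinuousMap.id M).prodMap jV) =
      jV.comp (ContinuousMap.snd : C(M × V, V)) := by
    ext p
    rfl
  rw [map_lhMap F deg _ _ _ _ hsq] at hz
  have hx_id : (fun j : Idx deg n ↦ singularCohomology.map F F (ContinuousMap.id M) (n - deg j.1) (x j)) = x := by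
    funext j
    rw [singularCohomology.map_id]
    rfl
  rw [hx_id] at hz
  have hres : ∀ j : Σ q : Fin (D + 1), σ q,
      singularCohomology.map F F ((ContinuousMap.id M).prodMap jV) (deg j) (sndCls F v M j) =
        singularCohomology.map F F (ContinuousMap.snd : C(M × V, V)) (deg j) (singularCohomology.map F F jV (deg j) (v j.1 j.2)) := by
    intro j
    change singularCohomology.map F F _ _ (singularCohomology.map F F _ _ _) = _
    rw [← ModuleCat.comp_apply, ← singularCohomology.map_comp, hsq', singularCohomology.map_comp, ModuleCat.comp_apply]
  -- both comparison sums, term by term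
  let T : (q : Fin (l' + 1)) → σ (Fin.castLE hl q) → singularCohomology F F (M × V) n := fun q i ↦
    if h : (q : ℕ) ≤ n then cupProduct (Nat.sub_add_cancel h)
      (singularCohomology.map F F (ContinuousMap.fst : C(M × V, M)) (n - q)
        (x ⟨⟨Fin.castLE hl q, i⟩, h⟩ : singularCohomology F F M (n - q)))
      (singularCohomology.map F F (ContinuousMap.snd : C(M × V, V)) q (w q i)) else 0
  have hT_pos : ∀ (q : Fin (l' + 1)) (i : σ (Fin.castLE hl q)) (h : (q : ℕ) ≤ n), T q i = cupProduct (Nat.sub_add_cancel h)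
      (singularCohomology.map F F (ContinuousMap.fst : C(M × V, M)) (n - q)
        (x ⟨⟨Fin.castLE hl q, i⟩, h⟩ : singularCohomology F F M (n - q)))
      (singularCohomology.map F F (ContinuousMap.snd : C(M × V, V)) q (w q i)) := fun q i h ↦ dif_pos h
  have hT_neg : ∀ (q : Fin (l' + 1)) (i : σ (Fin.castLE hl q)), ¬ (q : ℕ) ≤ n → T q i = 0 := fun q i h ↦ dif_neg h
  have hL : lhMap F deg (ContinuousMap.fst : C(M × V, M))
      (fun j ↦ singularCohomology.map F F ((ContinuousMap.id M).prodMap jV) (deg j) (sndCls F v M j)) n x =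
      ∑ q : Fin (l' + 1), ∑ i, T q i := by
    rw [lhMap_apply, Fintype.sum_sigma, sum_fin_eq_sum_fin_castLE hl]
    · refine Finset.sum_congr rfl fun q _ ↦ Finset.sum_congr rfl fun i _ ↦ ?_
      by_cases hq : (q : ℕ) ≤ n
      · rw [dif_pos (show deg (σ := σ) ⟨Fin.castLE hl q, i⟩ ≤ n from hq), hT_pos q i hq, hres]
        rfl
      · rw [dif_neg (show ¬ deg (σ := σ) ⟨Fin.castLE hl q, i⟩ ≤ n from hq), hT_neg q i hq]
    · intro q hq
      refine Finset.sum_eq_zero fun i _ ↦ ?_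
      by_cases hqn : (q : ℕ) ≤ n
      · rw [dif_pos (show deg (σ := σ) ⟨q, i⟩ ≤ n from hqn), hres]
        haveI := hVvan q hq
        rw [Subsingleton.elim (singularCohomology.map F F jV (deg (σ := σ) ⟨q, i⟩) (v q i)) 0, map_zero, map_zero]
      · rw [dif_neg (show ¬ deg (σ := σ) ⟨q, i⟩ ≤ n from hqn)]
  have hR : lhMap F deg (ContinuousMap.fst : C(M × V, M)) (sndCls F vV M) n xt = ∑ q : Fin (l' + 1), ∑ i, T q i := by
    rw [lhMap_apply, Fintype.sum_sigma]
    refine Finset.sum_congr rfl fun q _ ↦ ?_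
    rw [Fintype.sum_sum_type]
    have hinr : (∑ t : Module.Basis.sumExtendIndex (hli q), if h : deg (σ := τ) ⟨q, Sum.inr t⟩ ≤ n then
        cupProduct (Nat.sub_add_cancel h)
          (singularCohomology.map F F (ContinuousMap.fst : C(M × V, M)) (n - deg (σ := τ) ⟨q, Sum.inr t⟩)
            (xt ⟨⟨q, Sum.inr t⟩, h⟩)) (sndCls F vV M ⟨q, Sum.inr t⟩) else 0) = 0 := by
      refine Finset.sum_eq_zero fun t _ ↦ ?_
      by_cases hq : (q : ℕ) ≤ n
      · rw [dif_pos (show deg (σ := τ) ⟨q, Sum.inr t⟩ ≤ n from hq)]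
        change cupProduct _ (singularCohomology.map F F _ _ (0 : singularCohomology F F M (n - q))) _ = 0
        rw [map_zero, LinearMap.map_zero₂]
      · rw [dif_neg (show ¬ deg (σ := τ) ⟨q, Sum.inr t⟩ ≤ n from hq)]
    rw [hinr, add_zero]
    refine Finset.sum_congr rfl fun i _ ↦ ?_
    by_cases hq : (q : ℕ) ≤ n
    · rw [dif_pos (show deg (σ := τ) ⟨q, Sum.inl i⟩ ≤ n from hq), hT_pos q i hq]
      change cupProduct (Nat.sub_add_cancel hq)
          (singularCohomology.map F F (ContinuousMap.fst : C(M × V, M)) (n - q)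
            (x ⟨⟨Fin.castLE hl q, i⟩, hq⟩ : singularCohomology F F M (n - q)))
          (singularCohomology.map F F (ContinuousMap.snd : C(M × V, V)) q (vV q (Sum.inl i))) = _
      rw [hvV_inl]
    · rw [dif_neg (show ¬ deg (σ := τ) ⟨q, Sum.inl i⟩ ≤ n from hq), hT_neg q i hq]
  have hxt : xt = 0 := hinjV ((hR.trans (hL.symm.trans hz)).trans (map_zero _).symm)
  -- read off the coefficient
  obtain ⟨⟨Q, i⟩, hQ⟩ := j
  change (Q : ℕ) < l' + 1 at hj
  have := congrFun hxt ⟨⟨⟨Q, hj⟩, Sum.inl i⟩, hQ⟩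
  exact this

/-! ### The vanishing criterion -/

include E in
/-- **Künneth rigidity.** Let `z ∈ Hⁿ(M × N; F)`, `k + l = n`, `l ≤ D + 1`. Suppose:
(1) for every `p ≤ k` a space `U p` over `M` (paracompact Hausdorff, charted on the model space) with
`j_p^* : Hᵖ(M) → Hᵖ(U p)` injective and `(j_p × id)^* z = 0`; (2) a space `V` over `N` with
`j_V^* : H^q(N) → H^q(V)` injective for `q < l`, `H^q(V) = 0` for `q ≥ l`, all `H^q(V)`
finite-dimensional, and `(id × j_V)^* z = 0`. Then `z = 0`. [cite: HatcherAT2002, §3.2 Thm. 3.16] -/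
theorem eq_zero_of_tests
    (hv : ∀ q, Bijective fun r : σ q → F ↦ ∑ i, r i • v q i)
    (hD : ∀ q, D < q → Subsingleton (singularCohomology F F N q))
    {k l n : ℕ} (hkl : k + l = n) (hl : l ≤ D + 1) (z : singularCohomology F F (M × N) n)
    (U : ℕ → Type) [∀ p, TopologicalSpace (U p)] [∀ p, ChartedSpace E (U p)] [∀ p, T2Space (U p)]
    [∀ p, ParacompactSpace (U p)] (jU : ∀ p, C(U p, M))
    (hUinj : ∀ p ≤ k, Injective (singularCohomology.map F F (jU p) p))
    (hUvan : ∀ p ≤ k, singularCohomology.map F F ((jU p).prodMap (ContinuousMap.id N)) n z = 0)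
    {V : Type} [TopologicalSpace V] (jV : C(V, N))
    (hVinj : ∀ q : Fin (D + 1), (q : ℕ) < l → Injective (singularCohomology.map F F jV q))
    (hVvan : ∀ q, l ≤ q → Subsingleton (singularCohomology F F V q))
    (hVfin : ∀ q, Module.Finite F (singularCohomology F F V q))
    (hVz : singularCohomology.map F F ((ContinuousMap.id M).prodMap jV) n z = 0) : z = 0 := by
  have he := bijective_lhMap_const_of_basis F v hv hD
  obtain ⟨x, rfl⟩ := (bijective_lhMap_fst_prod F deg (fun j ↦ v j.1 j.2) E he (M := M) n).2 z
  suffices hx : x = 0 by rw [hx, map_zero]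
  funext j
  by_cases hj : deg j.1 < l
  · exact coeff_eq_zero_of_map_snd_eq_zero F E v hv jV hl hVinj hVvan hVfin x hVz j hj
  · -- fibre degree `≥ l`: base degree `p = n - deg j ≤ k`
    have hp : n - deg j.1 ≤ k := by have := j.2; omega
    have h := map_coeff_eq_zero_of_map_prod_eq_zero F E v hv hD (jU (n - deg j.1)) x (hUvan _ hp) j
    exact hUinj _ hp (h.trans (map_zero _).symm)

end

end LerayHirsch

end Literature.AlgebraicTopology.SingularHomology
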